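import Literature.NumberTheory.EllipticCurves.ModularCurveEtaQuotientLogPeriod
import Literature.NumberTheory.EllipticCurves.ModularCurveEtaQuotientsProofs
import HarnessLib

/-!
# Weight-`0` `η`-quotients under the lower unipotent `W_N = (1 0; N 1)`: `g(W_Nτ) = e^{−(πi/12) Σ_δ (N/δ) r_δ} g(τ)`, any level

Cell bsd-f2-manin, route `ManinLocalTwoThree` (crux C2 `ManinOddAtFour`, stmt-22967), prover seat p2 gen 26.  Level-free form of the
`W = (1 0; 24 1)`-law of `NewformFortyEight` (used there to show that the trace `S₂(Γ₀(48)) → S₂(Γ₀(24))` kills `φ₄₈` and to control the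
cusp `1/24`), for the sibling levels (`64 = 2·32`, `80`, `144`, …) where the same trace / cusp computations recur:

* §1 the Dedekind sum `s(1, k) = (k − 1)(k − 2)/(12k)` for every `k ≥ 1` (sum of `((μ/k))²`), hence Rademacher's
  `Φ(1, 0; c, 1) = 3 − c` for every `c ≥ 1`;
* §2 for `g = ∏_{δ∣N} η(δτ)^{r_δ}` of weight `0` (`Σ r_δ = 0`) and any `W ∈ SL₂(ℤ)` with entries `(1, 0; N, 1)`:
  `g(Wτ) = exp(−(πi/12) Σ_{δ∣N} (N/δ) r_δ) · g(τ)` (Dedekind's functional equation factor by factor, tree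
  `etaQuotient_smul_eq_cexp_sum_rademacherPhi`).  In particular `g∘W = g` iff `24 ∣ Σ (N/δ) r_δ`, and `g∘W = −g` iff
  `Σ (N/δ) r_δ ≡ 12 (mod 24)`.

No definition, no named fact, no sorry; nothing here proves C2, Manin's conjecture or BSD.
[cite: RademacherGrosswald1972, Ch. 1 eq. (1), Ch. 4 A eq. (59)–(60)] [cite: Apostol1990, Thm. 3.4]
-/

set_option autoImplicit false
-- lint-debt: the directory name repeats the summit name (sibling precedent `ManinLocalTwoThreeNewformFortyEight.lean`)
set_option linter.dupNamespace false

noncomputable section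

open Complex
open UpperHalfPlane hiding I
open scoped Real MatrixGroups
open Literature.NumberTheory.ModularForms
open Literature.NumberTheory.EllipticCurves Literature.NumberTheory.EllipticCurves.ModularForms

namespace Summit.BirchSwinnertonDyer.BirchSwinnertonDyer.Theorems.ManinLocalTwoThree.EtaQuotientLowerUnipotent

/-! ## §1 `s(1, k) = (k−1)(k−2)/(12k)` and `Φ(1, 0; c, 1) = 3 − c` -/

/-- `Σ_{μ<n} ((μ+1)/k − ½)² = n(n+1)(2n+1)/(6k²) − n(n+1)/(2k) + n/4` (sums of the first `n` integers and squares). [folklore] -/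
theorem sum_range_sq_shift (k : ℚ) (n : ℕ) :
    ∑ μ ∈ Finset.range n, (((μ : ℚ) + 1) / k - 1 / 2) ^ 2
      = (n : ℚ) * (n + 1) * (2 * n + 1) / 6 / k ^ 2 - (n : ℚ) * (n + 1) / 2 / k + n / 4 := by
  induction n with
  | zero => simp
  | succ n ih =>
    rw [Finset.sum_range_succ, ih]
    push_cast
    ring

/-- **`s(1, k) = (k − 1)(k − 2)/(12k)`** for `k ≥ 1` (`((0)) = 0`, `((μ/k)) = μ/k − ½` for `0 < μ < k`).
[cite: RademacherGrosswald1972, Ch. 1 eq. (1)] -/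
theorem dedekindSum_one (k : ℕ) (hk : 0 < k) :
    dedekindSum 1 k = ((k : ℚ) - 1) * ((k : ℚ) - 2) / (12 * k) := by
  obtain ⟨j, rfl⟩ : ∃ j, k = j + 1 := ⟨k - 1, by omega⟩
  have hk0 : ((j + 1 : ℕ) : ℚ) ≠ 0 := by positivity
  rw [dedekindSum_def, Finset.sum_range_succ']
  have h0 : dedekindSaw (((0 : ℕ) : ℚ) / ((j + 1 : ℕ) : ℚ)) * dedekindSaw (((1 : ℤ) : ℚ) * ((0 : ℕ) : ℚ) / ((j + 1 : ℕ) : ℚ)) = 0 := by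
    rw [Nat.cast_zero, zero_div, dedekindSaw_of_fract_eq_zero (by simp), zero_mul]
  rw [h0, add_zero]
  have hterm : ∀ μ ∈ Finset.range j,
      dedekindSaw (((μ + 1 : ℕ) : ℚ) / ((j + 1 : ℕ) : ℚ)) * dedekindSaw (((1 : ℤ) : ℚ) * ((μ + 1 : ℕ) : ℚ) / ((j + 1 : ℕ) : ℚ))
        = ((((μ : ℚ) + 1) / ((j + 1 : ℕ) : ℚ)) - 1 / 2) ^ 2 := by
    intro μ hμ
    rw [Finset.mem_range] at hμ
    have hpos : (0 : ℚ) < ((μ + 1 : ℕ) : ℚ) / ((j + 1 : ℕ) : ℚ) := by positivity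
    have hlt : ((μ + 1 : ℕ) : ℚ) / ((j + 1 : ℕ) : ℚ) < 1 := by
      rw [div_lt_one (by positivity)]
      exact_mod_cast Nat.succ_lt_succ hμ
    rw [Int.cast_one, one_mul, dedekindSaw_of_pos_of_lt_one hpos hlt]
    push_cast
    ring
  rw [Finset.sum_congr rfl hterm, sum_range_sq_shift]
  push_cast
  field_simp
  ring

/-- **`Φ(1, 0; c, 1) = 3 − c`** for every integer `c ≥ 1` (`Φ = (a + d)/c − 12 s(d, c)` with `s(1, c) = (c−1)(c−2)/(12c)`).
[cite: RademacherGrosswald1972, Ch. 4 A, eq. (59)] -/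
theorem rademacherPhi_one_zero_one (c : ℕ) (hc : 0 < c) : rademacherPhi 1 0 c 1 = 3 - (c : ℚ) := by
  have hc0 : (c : ℚ) ≠ 0 := by positivity
  rw [rademacherPhi_of_c_ne_zero (by exact_mod_cast hc.ne'), Int.sign_eq_one_of_pos (by exact_mod_cast hc),
    Int.natAbs_natCast, dedekindSum_one c hc]
  push_cast
  field_simp
  ring

/-! ## §2 The transformation law under `W_N = (1 0; N 1)` -/

/-- **`g(W_Nτ) = exp(−(πi/12) Σ_{δ∣N} (N/δ) r_δ) · g(τ)`** for a weight-`0` `η`-quotient `g` of level `N` and `W_N = (1 0; N 1)`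
(each factor by Dedekind's functional equation at `(1, 0; N/δ, 1)`, `Φ(1, 0; N/δ, 1) − 3 = −N/δ`; the square roots cancel as `Σ r_δ = 0`).
[cite: Apostol1990, Thm. 3.4] [cite: RademacherGrosswald1972, Ch. 4 A, eq. (60)] -/
theorem etaQuotient_smul_lowerUnipotent (N : ℕ) (hN : 0 < N) (r : ℕ → ℤ) (hsum : ∑ t ∈ N.divisors, r t = 0)
    (W : SL(2, ℤ)) (h00 : W 0 0 = 1) (h01 : W 0 1 = 0) (h10 : W 1 0 = N) (h11 : W 1 1 = 1) (τ : ℍ) :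
    etaQuotient N r (W • τ)
      = cexp (-(π * I / 12 * ((∑ t ∈ N.divisors, ((N / t : ℕ) : ℤ) * r t : ℤ) : ℂ))) * etaQuotient N r τ := by
  have h := etaQuotient_smul_eq_cexp_sum_rademacherPhi N r hsum W (by rw [h10]) (by rw [h10]; exact_mod_cast hN) τ
  rw [h, h00, h01, h10, h11]
  congr 1
  congr 1
  rw [Int.cast_sum, Finset.mul_sum, ← Finset.sum_neg_distrib]
  refine Finset.sum_congr rfl fun t ht ↦ ?_
  have htd : t ∣ N := Nat.dvd_of_mem_divisors ht
  have ht0 : 0 < t := Nat.pos_of_mem_divisors ht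
  have hq : ((N : ℤ) / (t : ℤ)) = ((N / t : ℕ) : ℤ) := by
    rw [Int.natCast_div]
  have hqpos : 0 < N / t := Nat.div_pos (Nat.le_of_dvd hN htd) ht0
  rw [zero_mul, hq, rademacherPhi_one_zero_one (N / t) hqpos]
  simp only [Int.cast_mul, Int.cast_natCast, Rat.cast_sub, Rat.cast_natCast, Rat.cast_ofNat]
  ring

/-- **Invariance criterion**: if `24 ∣ Σ (N/δ) r_δ` then `g∘W_N = g`. [cite: RademacherGrosswald1972, Ch. 4 A, eq. (60)] -/
theorem etaQuotient_smul_lowerUnipotent_of_dvd (N : ℕ) (hN : 0 < N) (r : ℕ → ℤ) (hsum : ∑ t ∈ N.divisors, r t = 0)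
    (h24 : (24 : ℤ) ∣ ∑ t ∈ N.divisors, ((N / t : ℕ) : ℤ) * r t)
    (W : SL(2, ℤ)) (h00 : W 0 0 = 1) (h01 : W 0 1 = 0) (h10 : W 1 0 = N) (h11 : W 1 1 = 1) (τ : ℍ) :
    etaQuotient N r (W • τ) = etaQuotient N r τ := by
  rw [etaQuotient_smul_lowerUnipotent N hN r hsum W h00 h01 h10 h11 τ]
  obtain ⟨m, hm⟩ := h24
  rw [hm, show (-(π * I / 12 * ((24 * m : ℤ) : ℂ)) : ℂ) = (-m : ℤ) * (2 * π * I) by push_cast; ring,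
    Complex.exp_int_mul_two_pi_mul_I, one_mul]

/-- **Sign criterion**: if `Σ (N/δ) r_δ ≡ 12 (mod 24)` then `g∘W_N = −g`. [cite: RademacherGrosswald1972, Ch. 4 A, eq. (60)] -/
theorem etaQuotient_smul_lowerUnipotent_of_mod (N : ℕ) (hN : 0 < N) (r : ℕ → ℤ) (hsum : ∑ t ∈ N.divisors, r t = 0)
    (h12 : (24 : ℤ) ∣ (∑ t ∈ N.divisors, ((N / t : ℕ) : ℤ) * r t) - 12)
    (W : SL(2, ℤ)) (h00 : W 0 0 = 1) (h01 : W 0 1 = 0) (h10 : W 1 0 = N) (h11 : W 1 1 = 1) (τ : ℍ) :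
    etaQuotient N r (W • τ) = -etaQuotient N r τ := by
  rw [etaQuotient_smul_lowerUnipotent N hN r hsum W h00 h01 h10 h11 τ]
  obtain ⟨m, hm⟩ := h12
  have hs : (∑ t ∈ N.divisors, ((N / t : ℕ) : ℤ) * r t) = 24 * m + 12 := by linarith
  rw [hs, show (-(π * I / 12 * ((24 * m + 12 : ℤ) : ℂ)) : ℂ) = (-m : ℤ) * (2 * π * I) + -(π * I) by push_cast; ring,
    Complex.exp_add, Complex.exp_int_mul_two_pi_mul_I, one_mul, Complex.exp_neg, Complex.exp_pi_mul_I]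
  norm_num

end Summit.BirchSwinnertonDyer.BirchSwinnertonDyer.Theorems.ManinLocalTwoThree.EtaQuotientLowerUnipotent

end
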